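import Literature.NumberTheory.NumberFields.EquivariantIwasawaLemmaClassGroup
import HarnessLib

/-!
# Equivariant Artin reciprocity, COUNTING form: the inertia-trivial `Γ`-equivariant characters of
# `Gal(H_F/B)` are at most as many as the `Γ`-equivariant additive maps `Cl(𝓞_B) → V` (PROVED)

Topic `NumberTheory/NumberFields` (namespace = path, grouping sub-namespace `EquivariantIwasawaLemma`).
THEOREM-ONLY file (no definition, no named fact, no `sorry`), written by the literature seat
`bsd-potss-conjA-anchor` g19 (cell `bsd-potss`; serves the asides stmt-BirchSwinnertonDyer-19386 /
19413; closes nothing; neither Conjecture A nor BSD is proved for any curve here).  It is the COUNTING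
refinement of `EquivariantIwasawaLemma.inertiaTrivialHom_eq_zero_of_classGroupHom_eq_zero`
(`EquivariantIwasawaLemmaClassGroup.lean`, seat g16), whose proof it follows line by line:

* **`card_le_card_equivariantHom_classGroup`** — `k ⊆ B ⊆ F` number fields, `F/k` and `B/k` Galois,
  `F/B` unramified at the infinite places; a group `Γ` with a homomorphism `π : Γ → Gal(F/k)` (NOT assumed
  onto — so `Γ` may be the absolute Galois group of an intermediate field) acting on a FINITE additive
  group `V`.  For a finite set `T` of maps `χ : Gal(H_F/B) → V` (`H_F` the Hilbert class field of `F`),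
  each additive, killing the inertia group of every prime of `H_F`, and `Γ`-equivariant under conjugation
  by lifts of `π(Γ)`, one has
  `#T ≤ #{μ : Cl(𝓞_B) → V additive, μ(τ|_B · c) = τ • μ(c) for all τ ∈ Γ}`
  (class-group equivariance through `τ ↦ ClassGroup.mulEquiv (intAut ((π τ)|_B))`, the currency of the
  door-L6 theorems).  PROOF (Cox Thm. 8.10 / Neukirch VI (6.9) with the equivariance of the Artin symbol,
  Neukirch IV §6): let `K = ⋂_{χ ∈ T} ker χ ≤ G = Gal(H_F/B)`; it is normal, contains the commutators
  and the inertia groups, and is stable under conjugation by the lifts of `π(Γ)` (equivariance); its fixed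
  field `P` is Galois over `B` with abelian group `G/K`, unramified at every finite prime and at infinity,
  and stable under those lifts.  Embedding `H_F` into `B̄` (`IsAlgClosed.lift`) carries `P` to a subfield
  `P♭ ≤ H_B` of the Hilbert class field of `B` (maximality, tree `le_hilbertClassField`), and the
  composite `s : Cl(B) ≅ Gal(H_B/B) ↠ Gal(P♭/B) ≅ Gal(P/B)` is ONTO.  Every `χ ∈ T` factors through
  `Gal(P/B)`, giving `μ_χ := χ̄ ∘ s`, additive and — by the equivariance of the Artin isomorphism (tree
  `hilbertClassField.artinEquiv_mulEquiv_intAut_apply`) — `Γ`-equivariant; and `χ ↦ μ_χ` is injective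
  because `s` and `G ↠ Gal(P/B)` are onto.  With `T = {χ}` and the count `0` on the right this is g16's
  vanishing statement again.

This is the class-field-theoretic step of the cell's ISOTYPIC BOUNDED-MULTIPLICITY criterion for
Coates–Sujatha's Conjecture A («`sup_n #Hom_G(Cl(L_n), E[p]) < ∞` along `L_n = K(E[p])K_n` ⟹ (A)»,
the `λ`-tolerant form of Coates–Sujatha 2005 Lemma 3.8 / Thm. 3.4), assembled in the `EllipticCurves`
topic; nothing about elliptic curves is used here.

## References

* D. A. Cox, *Primes of the form x² + ny²*, 2nd ed. (2013), §8.A Thm. 8.10, §5.C Cor. 5.24. [Cox2013]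
* J. Neukirch, *Algebraic Number Theory* (1999), Ch. VI (6.9), (7.1); Ch. IV §6; Ch. I §9. [NeukirchANT1999]
* J. Coates, R. Sujatha, *Fine Selmer groups of elliptic curves over p-adic Lie extensions*,
  Math. Ann. 331 (2005), §3 Lemma 3.8 and Thm. 3.4 (proof). [CoatesSujatha2005]
-/

noncomputable section

open scoped Pointwise commutatorElement
open NumberField IsDedekindDomain Ideal

namespace Literature.NumberTheory.NumberFields

namespace EquivariantIwasawaLemma

open Literature.NumberTheory.NumberFields.hilbertClassField

section ClassGroup

variable {k B F : Type} [Field k] [Field B] [NumberField B] [Field F] [NumberField F]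
  [Algebra k B] [Algebra k F] [Algebra B F] [IsScalarTower k B F] [IsGalois k F] [IsGalois k B]
  [IsUnramifiedAtInfinitePlaces B F]

omit [NumberField B] [NumberField F] [Algebra k F] [Algebra B F] [IsScalarTower k B F] [IsGalois k F]
  [IsUnramifiedAtInfinitePlaces B F] in
/-- `g̃⁻¹` moves `B` by `(g̃|_B)⁻¹`. [folklore] -/
private theorem symm_algebraMap' {E : Type*} [Field E] [Algebra k E] [Algebra B E] [IsScalarTower k B E]
    (g : E ≃ₐ[k] E) (x : B) :
    g.symm (algebraMap B E x) = algebraMap B E ((g.restrictNormal B).symm x) := by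
  apply g.injective
  rw [AlgEquiv.apply_symm_apply, ← AlgEquiv.restrictNormal_commutes, AlgEquiv.apply_symm_apply]

omit [NumberField B] [NumberField F] [Algebra k F] [Algebra B F] [IsScalarTower k B F] [IsGalois k F]
  [IsUnramifiedAtInfinitePlaces B F] in
/-- For `g̃ ∈ Aut(E/k)` and `σ ∈ Aut(E/B)` (`B/k` normal) the conjugate `g̃ σ g̃⁻¹` is `B`-linear.
[folklore] -/
private theorem exists_conj' {E : Type*} [Field E] [Algebra k E] [Algebra B E] [IsScalarTower k B E]
    (g : E ≃ₐ[k] E) (σ : E ≃ₐ[B] E) :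
    ∃ σ' : E ≃ₐ[B] E, ∀ y, σ' y = g (σ (g.symm y)) := by
  refine ⟨AlgEquiv.ofRingEquiv (f := g.symm.toRingEquiv.trans (σ.toRingEquiv.trans g.toRingEquiv))
    fun x => ?_, fun y => rfl⟩
  change g (σ (g.symm (algebraMap B E x))) = algebraMap B E x
  rw [symm_algebraMap', AlgEquiv.commutes, ← AlgEquiv.restrictNormal_commutes, AlgEquiv.apply_symm_apply]

set_option maxHeartbeats 4000000 in
/-- **Counting form of equivariant Artin reciprocity.**  `k ⊆ B ⊆ F` number fields, `F/k` and `B/k`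
Galois, `F/B` unramified at the infinite places; `Γ` acts on the finite additive group `V` and maps to
`Gal(F/k)` by `π` (not necessarily onto).  For a finite set `T` of maps `χ : Gal(H_F/B) → V`, each
additive, killing all inertia groups, and `Γ`-equivariant under conjugation by the lifts of `π(Γ)` to
`Gal(H_F/k)`, the number of elements of `T` is at most the number of `Γ`-equivariant additive maps
`μ : Cl(𝓞_B) → V` (equivariance through `ClassGroup.mulEquiv (intAut ((π τ)|_B))`): each `χ` is
`μ_χ ∘ (Artin symbol)` for a unique such `μ_χ` (see the module docstring).
[cite: Cox2013, §8.A Thm. 8.10 and §5.C Cor. 5.24]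
[cite: NeukirchANT1999, Ch. VI (6.9), (7.1) and Ch. IV §6 (equivariance of the Artin symbol)]
[cite: CoatesSujatha2005, §3 Lemma 3.8 (the `Hom_G(·, E[p])`-count behind Thm. 3.4)] -/
theorem card_le_card_equivariantHom_classGroup
    {Γ : Type*} [Group Γ] (π : Γ →* (F ≃ₐ[k] F))
    {V : Type*} [AddCommGroup V] [Finite V] [DistribMulAction Γ V]
    (T : Finset ((hilbertClassField F ≃ₐ[B] hilbertClassField F) → V))
    (hTadd : ∀ χ ∈ T, ∀ a b, χ (a * b) = χ a + χ b)
    (hTI : ∀ χ ∈ T, ∀ (Q : Ideal (𝓞 (hilbertClassField F))) [Q.IsMaximal],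
      ∀ s ∈ Q.inertia (hilbertClassField F ≃ₐ[B] hilbertClassField F), χ s = 0)
    (hTequiv : ∀ χ ∈ T, ∀ (τ : Γ) (g : hilbertClassField F ≃ₐ[k] hilbertClassField F)
      (a a' : hilbertClassField F ≃ₐ[B] hilbertClassField F),
      AlgEquiv.restrictNormalHom F g = π τ → (∀ y, a' y = g (a (g.symm y))) → χ a' = τ • χ a) :
    T.card ≤ Nat.card {μ : Additive (ClassGroup (𝓞 B)) →+ V //
      ∀ (τ : Γ) (c : ClassGroup (𝓞 B)),
        μ (Additive.ofMul (ClassGroup.mulEquiv (AmbiguousClass.intAut ((π τ).restrictNormal B)) c)) =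
          τ • μ (Additive.ofMul c)} := by
  classical
  -- ### Galois setup
  haveI : CharZero k := (algebraMap k F).charZero
  haveI : FiniteDimensional k F := Module.Finite.of_restrictScalars_finite ℚ k F
  haveI : FiniteDimensional k B := Module.Finite.of_restrictScalars_finite ℚ k B
  haveI : IsGalois B F := IsGalois.tower_top_of_isGalois k B F
  haveI : IsScalarTower k F (hilbertClassField F) :=
    IsScalarTower.of_algebraMap_eq fun x => Subtype.ext (IsScalarTower.algebraMap_apply k F _ x)
  haveI : IsScalarTower B F (hilbertClassField F) :=
    IsScalarTower.of_algebraMap_eq fun x => Subtype.ext (IsScalarTower.algebraMap_apply B F _ x)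
  haveI : IsScalarTower k B (hilbertClassField F) := IsScalarTower.of_algebraMap_eq fun x => by
    rw [IsScalarTower.algebraMap_apply B F (hilbertClassField F),
      ← IsScalarTower.algebraMap_apply k B F, ← IsScalarTower.algebraMap_apply k F (hilbertClassField F)]
  haveI : IsGalois k (hilbertClassField F) := hilbertClassField.isGalois_of_isGalois F (K := k)
  haveI : IsGalois B (hilbertClassField F) := hilbertClassField.isGalois_of_isGalois F (K := B)
  haveI : FiniteDimensional B (hilbertClassField F) := Module.Finite.trans F (hilbertClassField F)
  haveI : IsUnramifiedAtInfinitePlaces B (hilbertClassField F) :=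
    IsUnramifiedAtInfinitePlaces.trans B F (hilbertClassField F)
  haveI : IsGalois k (hilbertClassField B) := hilbertClassField.isGalois_of_isGalois B (K := k)
  obtain ⟨rk, hrk⟩ : ∃ rk : (hilbertClassField F ≃ₐ[k] hilbertClassField F) →* (F ≃ₐ[k] F),
      rk = AlgEquiv.restrictNormalHom F := ⟨_, rfl⟩
  have hrk_apply : ∀ g x, algebraMap F (hilbertClassField F) (rk g x) = g (algebraMap F _ x) := by
    intro g x; rw [hrk]; exact AlgEquiv.restrictNormal_commutes g F x
  -- ### elementary consequences of additivity, for the members of `T`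
  have hT1 : ∀ χ ∈ T, χ 1 = 0 := by
    intro χ hχ
    have h := hTadd χ hχ 1 1; rw [mul_one] at h; exact left_eq_add.mp h
  have hTinv : ∀ χ ∈ T, ∀ a, χ a⁻¹ = -χ a := by
    intro χ hχ a
    have h := hTadd χ hχ a⁻¹ a
    rw [inv_mul_cancel, hT1 χ hχ] at h
    exact eq_neg_of_add_eq_zero_left h.symm
  -- ### `K = ⋂_{χ ∈ T} ker χ`, a normal subgroup containing commutators and inertia, stable under the
  -- lifts of `π(Γ)`
  obtain ⟨K, hmemK⟩ : ∃ K : Subgroup (hilbertClassField F ≃ₐ[B] hilbertClassField F),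
      ∀ x, x ∈ K ↔ ∀ χ ∈ T, χ x = 0 :=
    ⟨{ carrier := {x | ∀ χ ∈ T, χ x = 0}
       mul_mem' := fun {a b} ha hb χ hχ => by
         rw [hTadd χ hχ, ha χ hχ, hb χ hχ, add_zero]
       one_mem' := fun χ hχ => hT1 χ hχ
       inv_mem' := fun {a} ha χ hχ => by rw [hTinv χ hχ, ha χ hχ, neg_zero] }, fun _ => Iff.rfl⟩
  haveI hKn : K.Normal := ⟨fun n hn g => (hmemK _).2 fun χ hχ => by
    rw [hTadd χ hχ, hTadd χ hχ, (hmemK n).1 hn χ hχ, add_zero, ← hTadd χ hχ, mul_inv_cancel,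
      hT1 χ hχ]⟩
  have hcommK : ⁅(⊤ : Subgroup (hilbertClassField F ≃ₐ[B] hilbertClassField F)), ⊤⁆ ≤ K := by
    rw [Subgroup.commutator_le]
    intro g _ h _
    refine (hmemK _).2 fun χ hχ => ?_
    rw [commutatorElement_def, hTadd χ hχ, hTadd χ hχ, hTadd χ hχ, hTinv χ hχ, hTinv χ hχ]
    abel
  have hIK : ∀ (Q : Ideal (𝓞 (hilbertClassField F))) [Q.IsMaximal],
      Q.inertia (hilbertClassField F ≃ₐ[B] hilbertClassField F) ≤ K :=
    fun Q _ s hs => (hmemK s).mpr fun χ hχ => hTI χ hχ Q s hs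
  have hKconj : ∀ (τ : Γ) (g : hilbertClassField F ≃ₐ[k] hilbertClassField F), rk g = π τ →
      ∀ (n n' : hilbertClassField F ≃ₐ[B] hilbertClassField F),
      n ∈ K → (∀ y, n' y = g (n (g.symm y))) → n' ∈ K := by
    intro τ g hg n n' hn hn'
    rw [hmemK] at hn ⊢
    intro χ hχ
    rw [hTequiv χ hχ τ g n n' (by rw [← hrk]; exact hg) hn', hn χ hχ, smul_zero]
  -- ### the fixed field `P` of `K`: abelian, unramified, stable under the lifts of `π(Γ)`
  obtain ⟨P, hP⟩ : ∃ P : IntermediateField B (hilbertClassField F), P = IntermediateField.fixedField K :=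
    ⟨_, rfl⟩
  haveI : IsGalois B P := by rw [hP]; exact IsGalois.of_fixedField_normal_subgroup K
  haveI : NumberField P := NumberField.of_module_finite B P
  have hPfix : P.fixingSubgroup = K := by rw [hP, IntermediateField.fixingSubgroup_fixedField]
  -- `Gal(H_F/B) → Gal(P/B)` with kernel `K`
  obtain ⟨resP, hresP⟩ : ∃ resP : (hilbertClassField F ≃ₐ[B] hilbertClassField F) →* (P ≃ₐ[B] P),
      resP = AlgEquiv.restrictNormalHom P := ⟨_, rfl⟩
  have hresP_val : ∀ g (x : P), ((resP g x : P) : hilbertClassField F) = g (x : hilbertClassField F) := by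
    intro g x; rw [hresP]; exact AlgEquiv.restrictNormal_commutes g P x
  have hresP_surj : Function.Surjective resP := by
    rw [hresP]; exact AlgEquiv.restrictNormalHom_surjective (hilbertClassField F)
  have hresP_K : ∀ n, n ∈ K → resP n = 1 := by
    intro n hn
    rw [← hPfix, IntermediateField.mem_fixingSubgroup_iff] at hn
    apply AlgEquiv.ext
    intro x
    apply Subtype.ext
    rw [hresP_val, AlgEquiv.one_apply]
    exact hn x x.2
  have hresP_ker : ∀ χ ∈ T, ∀ g g', resP g = resP g' → χ g = χ g' := by
    intro χ hχ g g' h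
    have hmem : g⁻¹ * g' ∈ K := by
      rw [← hPfix, IntermediateField.mem_fixingSubgroup_iff]
      intro x hx
      have h1 : g' x = g x := by
        rw [← hresP_val g' ⟨x, hx⟩, ← hresP_val g ⟨x, hx⟩, h]
      rw [AlgEquiv.mul_apply, h1, AlgEquiv.aut_inv, AlgEquiv.symm_apply_apply]
    have : g' = g * (g⁻¹ * g') := by group
    rw [this, hTadd χ hχ, (hmemK _).mp hmem χ hχ, add_zero]
  haveI : IsAbelianGalois B P := by
    refine { is_comm := ⟨fun x y => ?_⟩ }
    obtain ⟨g, rfl⟩ := hresP_surj x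
    obtain ⟨g', rfl⟩ := hresP_surj y
    rw [← map_mul, ← map_mul]
    have hk : g * g' * (g' * g)⁻¹ ∈ K := by
      apply hcommK
      have : g * g' * (g' * g)⁻¹ = ⁅g, g'⁆ := by rw [commutatorElement_def]; group
      rw [this]
      exact Subgroup.commutator_mem_commutator (Subgroup.mem_top g) (Subgroup.mem_top g')
    have hk' := hresP_K _ hk
    rwa [map_mul, map_inv, mul_inv_eq_one] at hk'
  haveI : IsUnramifiedAtInfinitePlaces B P :=
    isUnramifiedAtInfinitePlaces_of_algHom (IsScalarTower.toAlgHom B P (hilbertClassField F))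
  have hunrP : ∀ v : HeightOneSpectrum (𝓞 B), Algebra.IsUnramifiedIn (𝓞 P) v.asIdeal := by
    intro v q hq hqv
    haveI := hq
    have hq0 : q ≠ ⊥ := by
      intro h0
      apply v.ne_bot
      rw [hqv.over, h0, Ideal.under_def, Ideal.comap_bot_of_injective _
        (FaithfulSMul.algebraMap_injective (𝓞 B) (𝓞 P))]
    haveI : q.IsMaximal := hq.isMaximal hq0
    obtain ⟨Q, hQmax, hQq⟩ := Ideal.exists_maximal_ideal_liesOver_of_isIntegral (S := 𝓞 (hilbertClassField F)) q
    haveI := hQmax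
    have hq' : q = Q.under (𝓞 P) := hQq.over
    subst hq'
    rw [isUnramifiedAt_under_iff_inertia_le' P Q, hPfix]
    exact hIK Q
  have hPstab : ∀ (τ : Γ) (g : hilbertClassField F ≃ₐ[k] hilbertClassField F), rk g = π τ →
      ∀ x : hilbertClassField F, x ∈ P → g.symm x ∈ P := by
    intro τ g hg x hx
    rw [hP, IntermediateField.mem_fixedField_iff] at hx ⊢
    intro n hn
    obtain ⟨n', hn'⟩ := exists_conj' g n
    have hn'K : n' ∈ K := hKconj τ g hg n n' hn hn'
    have h := hx n' hn'K
    rw [hn'] at h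
    -- `g (n (g⁻¹ x)) = x`, hence `n (g⁻¹ x) = g⁻¹ x`
    have h2 := congrArg g.symm h
    rwa [AlgEquiv.symm_apply_apply] at h2
  -- ### embedding into `B̄` and the Hilbert class field of `B`
  let ψ : hilbertClassField F →ₐ[B] AlgebraicClosure B := IsAlgClosed.lift
  obtain ⟨Pb, hPb⟩ : ∃ Pb : IntermediateField B (AlgebraicClosure B), Pb = P.map ψ := ⟨_, rfl⟩
  let e : P ≃ₐ[B] Pb := (IntermediateField.equivMap P ψ).trans (IntermediateField.equivOfEq hPb.symm)
  have he_val : ∀ x : P, ((e x : Pb) : AlgebraicClosure B) = ψ (x : hilbertClassField F) := fun _ => rfl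
  haveI : FiniteDimensional B Pb := LinearEquiv.finiteDimensional e.toLinearEquiv
  haveI : NumberField Pb := NumberField.of_module_finite B Pb
  haveI : IsAbelianGalois B Pb := IsAbelianGalois.of_algHom (e.symm : Pb →ₐ[B] P)
  haveI : IsUnramifiedAtInfinitePlaces B Pb := isUnramifiedAtInfinitePlaces_of_algHom (e.symm : Pb →ₐ[B] P)
  have hunrPb := forall_isUnramifiedIn_of_algHom (e.symm : Pb →ₐ[B] P) hunrP
  have hle : Pb ≤ hilbertClassField B := le_hilbertClassField B Pb hunrPb
  -- `Gal(H_B/B) → Gal(P♭/B)`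
  letI algPb : Algebra Pb (hilbertClassField B) := (IntermediateField.inclusion hle).toRingHom.toAlgebra
  haveI : IsScalarTower B Pb (hilbertClassField B) := IsScalarTower.of_algebraMap_eq fun _ => rfl
  have hincl_val : ∀ y : Pb, ((algebraMap Pb (hilbertClassField B) y : hilbertClassField B) :
      AlgebraicClosure B) = (y : AlgebraicClosure B) := fun _ => rfl
  obtain ⟨resPb, hresPb⟩ : ∃ resPb : (hilbertClassField B ≃ₐ[B] hilbertClassField B) →* (Pb ≃ₐ[B] Pb),
      resPb = AlgEquiv.restrictNormalHom Pb := ⟨_, rfl⟩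
  have hresPb_val : ∀ h (y : Pb), ((resPb h y : Pb) : AlgebraicClosure B) =
      ((h (algebraMap Pb (hilbertClassField B) y) : hilbertClassField B) : AlgebraicClosure B) := by
    intro h y
    rw [← hincl_val (resPb h y), hresPb]
    exact congrArg (fun z : hilbertClassField B => (z : AlgebraicClosure B))
      (AlgEquiv.restrictNormal_commutes h Pb y)
  have hresPb_surj : Function.Surjective resPb := by
    rw [hresPb]; exact AlgEquiv.restrictNormalHom_surjective (hilbertClassField B)
  -- the transported functional `ν` on `Gal(P/B)` and `μ` on `Cl(B)`
  let L : (P ≃ₐ[B] P) → (hilbertClassField F ≃ₐ[B] hilbertClassField F) := Function.surjInv hresP_surj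
  have hL : ∀ w, resP (L w) = w := Function.surjInv_eq hresP_surj
  let eaut : (P ≃ₐ[B] P) ≃* (Pb ≃ₐ[B] Pb) := e.autCongr
  have heaut : ∀ w y, eaut w y = e (w (e.symm y)) := fun _ _ => rfl
  -- `μ_χ := χ̄ ∘ s` for every `χ` (additive and well defined for `χ ∈ T`)
  let μ : ((hilbertClassField F ≃ₐ[B] hilbertClassField F) → V) → ClassGroup (𝓞 B) → V :=
    fun χ c => χ (L (eaut.symm (resPb (artinEquiv B c))))
  have hμ_of : ∀ χ ∈ T, ∀ c g, resP g = eaut.symm (resPb (artinEquiv B c)) → μ χ c = χ g := by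
    intro χ hχ c g hg
    exact hresP_ker χ hχ _ _ (by rw [hL, hg])
  have hμmul : ∀ χ ∈ T, ∀ c c', μ χ (c * c') = μ χ c + μ χ c' := by
    intro χ hχ c c'
    rw [hμ_of χ hχ (c * c') (L (eaut.symm (resPb (artinEquiv B c))) * L (eaut.symm (resPb (artinEquiv B c'))))
      (by rw [map_mul, hL, hL, map_mul, map_mul, map_mul]), hTadd χ hχ]
  -- ### equivariance of `μ_χ`
  have hμequiv : ∀ χ ∈ T, ∀ (τ : Γ) (c : ClassGroup (𝓞 B)),
      μ χ (ClassGroup.mulEquiv (AmbiguousClass.intAut ((π τ).restrictNormal B)) c) = τ • μ χ c := by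
    intro χ hχ τ c
    -- the element `a₀` computing `μ c`, and its conjugate
    obtain ⟨a₀, ha₀⟩ : ∃ a₀, a₀ = L (eaut.symm (resPb (artinEquiv B c))) := ⟨_, rfl⟩
    have hμc : μ χ c = χ a₀ := by rw [ha₀]
    have ha₀r : resP a₀ = eaut.symm (resPb (artinEquiv B c)) := by rw [ha₀, hL]
    have hPbArt : resPb (artinEquiv B c) = eaut (resP a₀) := by rw [ha₀r, MulEquiv.apply_symm_apply]
    -- `ω ∈ Aut(B̄/k)` over `π τ`, its restrictions `τ̃` to `H_B` and `g̃` to `H_F`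
    let ψF : F →ₐ[B] AlgebraicClosure B := ψ.comp (IsScalarTower.toAlgHom B F (hilbertClassField F))
    letI algF : Algebra F (AlgebraicClosure B) := ψF.toRingHom.toAlgebra
    haveI : IsScalarTower B F (AlgebraicClosure B) := IsScalarTower.of_algebraMap_eq fun x => (ψF.commutes x).symm
    haveI : IsScalarTower k F (AlgebraicClosure B) := IsScalarTower.of_algebraMap_eq fun x => by
      rw [IsScalarTower.algebraMap_apply k B (AlgebraicClosure B), IsScalarTower.algebraMap_apply k B F,
        ← IsScalarTower.algebraMap_apply B F (AlgebraicClosure B)]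
    letI algH : Algebra (hilbertClassField F) (AlgebraicClosure B) := ψ.toRingHom.toAlgebra
    haveI : IsScalarTower B (hilbertClassField F) (AlgebraicClosure B) :=
      IsScalarTower.of_algebraMap_eq fun x => (ψ.commutes x).symm
    haveI : IsScalarTower k (hilbertClassField F) (AlgebraicClosure B) :=
      IsScalarTower.of_algebraMap_eq fun x => by
        rw [IsScalarTower.algebraMap_apply k B (AlgebraicClosure B), IsScalarTower.algebraMap_apply k B (hilbertClassField F),
          ← IsScalarTower.algebraMap_apply B (hilbertClassField F) (AlgebraicClosure B)]
    haveI : IsScalarTower F (hilbertClassField F) (AlgebraicClosure B) :=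
      IsScalarTower.of_algebraMap_eq fun x => rfl
    haveI : Algebra.IsAlgebraic k B := Algebra.IsAlgebraic.of_finite k B
    haveI : Normal k (AlgebraicClosure B) := IsAlgClosure.normal k (AlgebraicClosure B)
    let ω : AlgebraicClosure B ≃ₐ[k] AlgebraicClosure B := (π τ).liftNormal (AlgebraicClosure B)
    have hω : ∀ x : F, ω (ψF x) = ψF (π τ x) := fun x => AlgEquiv.liftNormal_commutes (π τ) _ x
    haveI : Normal k (hilbertClassField B) := inferInstance
    haveI : IsScalarTower k (hilbertClassField B) (AlgebraicClosure B) :=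
      IsScalarTower.of_algebraMap_eq fun _ => rfl
    let τt : hilbertClassField B ≃ₐ[k] hilbertClassField B := ω.restrictNormal (hilbertClassField B)
    have hτt_val : ∀ z : hilbertClassField B, ((τt z : hilbertClassField B) : AlgebraicClosure B) =
        ω (z : AlgebraicClosure B) := fun z => AlgEquiv.restrictNormal_commutes ω (hilbertClassField B) z
    have hτtsymm_val : ∀ z : hilbertClassField B, ((τt.symm z : hilbertClassField B) : AlgebraicClosure B) =
        ω.symm (z : AlgebraicClosure B) := by
      intro z; apply ω.injective; rw [← hτt_val, AlgEquiv.apply_symm_apply, AlgEquiv.apply_symm_apply]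
    let gt : hilbertClassField F ≃ₐ[k] hilbertClassField F := ω.restrictNormal (hilbertClassField F)
    have hgt_val : ∀ z : hilbertClassField F, ψ (gt z) = ω (ψ z) :=
      fun z => AlgEquiv.restrictNormal_commutes ω (hilbertClassField F) z
    have hgtsymm_val : ∀ z : hilbertClassField F, ψ (gt.symm z) = ω.symm (ψ z) := by
      intro z; apply ω.injective; rw [← hgt_val, AlgEquiv.apply_symm_apply, AlgEquiv.apply_symm_apply]
    -- `g̃` restricts to `π τ` on `F`, `τ̃` restricts to `(π τ)|_B` on `B`
    have hgt_rk : rk gt = π τ := by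
      apply AlgEquiv.ext
      intro x
      have hψinj : Function.Injective (ψ : hilbertClassField F → AlgebraicClosure B) :=
        ψ.toRingHom.injective
      apply (algebraMap F (hilbertClassField F)).injective
      apply hψinj
      rw [hrk_apply, hgt_val]
      exact hω x
    have hτtB : ∀ b : B, τt (algebraMap B (hilbertClassField B) b) =
        algebraMap B (hilbertClassField B) ((π τ).restrictNormal B b) := by
      intro b
      apply Subtype.ext
      rw [hτt_val]
      change ω (algebraMap B (AlgebraicClosure B) b) = algebraMap B (AlgebraicClosure B) ((π τ).restrictNormal B b)
      rw [IsScalarTower.algebraMap_apply B F (AlgebraicClosure B) b,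
        IsScalarTower.algebraMap_apply B F (AlgebraicClosure B) ((π τ).restrictNormal B b),
        AlgEquiv.restrictNormal_commutes]
      exact hω (algebraMap B F b)
    -- the conjugate `a'` of `a₀` by `g̃`
    obtain ⟨a', ha'⟩ := exists_conj' gt a₀
    have hχa' : χ a' = τ • χ a₀ := hTequiv χ hχ τ gt a₀ a' (by rw [← hrk]; exact hgt_rk) ha'
    rw [hμc, ← hχa']
    apply hμ_of χ hχ
    -- ### the key identity `resP a' = eaut⁻¹ (resPb (Artin (τ • c)))`
    apply eaut.injective
    rw [MulEquiv.apply_symm_apply]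
    apply AlgEquiv.ext
    intro y
    apply Subtype.ext
    -- write `y = e x`
    obtain ⟨x, rfl⟩ : ∃ x : P, e x = y := ⟨e.symm y, e.apply_symm_apply y⟩
    -- `τ̃⁻¹ (e x) = e (g̃⁻¹ x)` inside `H_B`
    have hx1 : gt.symm (x : hilbertClassField F) ∈ P := hPstab τ gt hgt_rk x x.2
    have hstep : τt.symm (algebraMap Pb (hilbertClassField B) (e x)) =
        algebraMap Pb (hilbertClassField B) (e ⟨gt.symm (x : hilbertClassField F), hx1⟩) := by
      apply Subtype.ext
      simp only [hτtsymm_val, hincl_val, he_val]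
      exact (hgtsymm_val _).symm
    have lhs : ((eaut (resP a') (e x) : Pb) : AlgebraicClosure B) =
        ω (ψ (a₀ (gt.symm (x : hilbertClassField F)))) := by
      rw [heaut, AlgEquiv.symm_apply_apply, he_val, hresP_val, ha', hgt_val]
    rw [lhs]
    symm
    rw [hresPb_val, artinEquiv_mulEquiv_intAut_apply B τt ((π τ).restrictNormal B) hτtB c, hτt_val,
      hstep, ← hresPb_val, hPbArt, heaut, AlgEquiv.symm_apply_apply, he_val, hresP_val]
  -- ### conclusion: `χ ↦ μ_χ` is an injection of `T` into the equivariant additive maps `Cl(B) → V`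
  haveI : Finite {μ : Additive (ClassGroup (𝓞 B)) →+ V //
      ∀ (τ : Γ) (c : ClassGroup (𝓞 B)),
        μ (Additive.ofMul (ClassGroup.mulEquiv (AmbiguousClass.intAut ((π τ).restrictNormal B)) c)) =
          τ • μ (Additive.ofMul c)} :=
    Finite.of_injective (fun ν => ((ν.1 : Additive (ClassGroup (𝓞 B)) →+ V) :
        Additive (ClassGroup (𝓞 B)) → V))
      (fun ν ν' h => Subtype.ext (DFunLike.coe_injective h))
  let Φ : ↥T → {μ : Additive (ClassGroup (𝓞 B)) →+ V //
      ∀ (τ : Γ) (c : ClassGroup (𝓞 B)),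
        μ (Additive.ofMul (ClassGroup.mulEquiv (AmbiguousClass.intAut ((π τ).restrictNormal B)) c)) =
          τ • μ (Additive.ofMul c)} := fun χ =>
    ⟨AddMonoidHom.mk' (fun c => μ χ.1 (Additive.toMul c)) fun c c' => by
        rw [toMul_add, hμmul χ.1 χ.2],
      fun τ c => by
        simp only [AddMonoidHom.mk'_apply, toMul_ofMul]
        exact hμequiv χ.1 χ.2 τ c⟩
  have hΦval : ∀ (χ : ↥T) (c : ClassGroup (𝓞 B)),
      (Φ χ).1 (Additive.ofMul c) = μ χ.1 c := fun χ c => by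
    simp only [Φ, AddMonoidHom.mk'_apply, toMul_ofMul]
  have hΦ : Function.Injective Φ := by
    intro χ₁ χ₂ h
    apply Subtype.ext
    funext a
    -- `χ₁ a` and `χ₂ a` are the values of `μ_{χ₁}` and `μ_{χ₂}` at one and the same class `c`
    obtain ⟨h', hh'⟩ := hresPb_surj (eaut (resP a))
    have h1 : μ χ₁.1 ((artinEquiv B).symm h') = χ₁.1 a :=
      hμ_of χ₁.1 χ₁.2 _ a (by rw [MulEquiv.apply_symm_apply, hh', MulEquiv.symm_apply_apply])
    have h2 : μ χ₂.1 ((artinEquiv B).symm h') = χ₂.1 a :=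
      hμ_of χ₂.1 χ₂.2 _ a (by rw [MulEquiv.apply_symm_apply, hh', MulEquiv.symm_apply_apply])
    rw [← h1, ← h2, ← hΦval χ₁, ← hΦval χ₂, h]
  have hcard := Nat.card_le_card_of_injective Φ hΦ
  rwa [Nat.card_eq_fintype_card, Fintype.card_coe] at hcard

end ClassGroup

end EquivariantIwasawaLemma

end Literature.NumberTheory.NumberFields

end
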